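import Literature.NumberTheory.EllipticCurves.IwasawaTwistModPShapiro
import Literature.NumberTheory.EllipticCurves.IwasawaTwistModPTower
import Literature.NumberTheory.GaloisRepresentations.ContinuousCorestrictionTransitive
import Literature.NumberTheory.GaloisRepresentations.EulerSystem
import HarnessLib

/-!
# Shapiro for the Iwasawa twists, II: the inverse Shapiro map `H¹(K_n, M) → H¹(K, 𝒯_{p^n})` IS
# "corestriction after `M ↪ 𝒯_{p^n}`", and the dictionary **corestriction ↔ truncation**

Topic `NumberTheory/EllipticCurves` (sequel of `IwasawaTwistModPShapiro`, `IwasawaTwistModPTower`);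
namespace `Literature.NumberTheory.EllipticCurves.ZpExtension`.  Cell `bsd-smallim` (rung K6 of
`BirchSwinnertonDyer`, crux `MuTransferX9` = item 19276, open stub `stub_coreX9` of the registered
skeleton v4 `0154dd5daf38efd6`), seat `bsd-smallim-k6-ty` (typer), item `defn-IwasawaTwistModPShapiro`
part (3) of the CORE-PLAN dictionary (HOME `plan/k6/lines/MuTransferX9_CORE-PLAN_k6c2.md` S2.1:
"cores ↔ truncation"): the bridge that carries a norm-compatible family
`(y_n)_n ∈ lim←_n H¹(K_n, M)` (the tree's `Kato2004.normCompatible`, e.g. the reduction `red s` of a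
`Λ`-adic class, `Kato2004/IwasawaH1Reduction.lean`) to a compatible family of the `T`-adic tower
`lim←_J H¹(K, 𝒯_J)` (`ZpExtension.twistTower`, k6-c2).  DEFINITIONS with bodies and PROOFS only; no
named fact, no `sorry`, no instance, no notation.

For a field `K` (with `Γ_K` compact — an instance BINDER as in `IwasawaTwistModPShapiro`), a
`ℤ_p`-extension `κ`, a discrete `Γ_K`-module `ρ` on `M` killed by `p`, and `n : ℕ`
(`Γ_n = κ.layerSubgroup n`, `𝒯_{p^n} = κ.twistModP ρ hM (p^n)`):

* `unitCoeff n : M →+ 𝒯_{p^n}`, `m ↦ m · T⁰` (`Pi.single 0 m`), which is `Γ_n`-equivariant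
  (`Γ_n` acts on `𝒯_{p^n}` through `ρ` alone, `twistModP_apply_of_mem_layerSubgroup`):
  `unitCoeffHom n : M|_{Γ_n} ⟶ 𝒯_{p^n}|_{Γ_n}` in `TopRep ℤ Γ_n`;
* **`coresShapiro n : H¹(Γ_n, M) →+ H¹(Γ_K, 𝒯_{p^n})`** `:= cor_{Γ_n}^{Γ_K} ∘ H¹(unitCoeff n)` — the
  classical formula for the inverse of Shapiro's isomorphism ("`Cor` is `H^q(H, A) = H^q(G, M_G^H(A))
  → H^q(G, A)` induced by `π`", Serre I §2.5 (b); NSW (1.6.4)–(1.6.5)): the transfer of the tree's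
  explicit corestriction `cores` (`ContinuousCorestriction.lean`) applied to `m · T⁰`-valued cocycles;
* **`twistModPH1Equiv_coresShapiro`**: `Sh_n (coresShapiro n c) = c` for the Shapiro bijection
  `Sh_n = twistModPH1Equiv κ ρ hM n : H¹(K, 𝒯_{p^n}) ≃ H¹(K_n, M)` of part I — PROVED on cocycles (the
  transfer cocycle, read in the group-ring basis `δ_{κ̄_n(g)}` through `twistGroupRingToModP`, has
  identity-coset coefficient `u ↦ ρ(u₀) φ(u₀⁻¹ u u₀)` with `u₀ ∈ Γ_n`, cohomologous to `φ`); hence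
  **`coresShapiro_eq_symm`**: `coresShapiro n = Sh_n⁻¹`, and `coresShapiro_bijective`;
* **`truncH1_coresShapiro_succ`** (cores ↔ truncation): `trunc_{p^n ← p^{n+1}} ∘ coresShapiro (n+1)
  = coresShapiro n ∘ cor_{Γ_{n+1} → Γ_n}` on `H¹(Γ_{n+1}, M)` — FORMAL from the transitivity of the
  transfer (`cores_coresLe_eq_cores`) and its naturality in the coefficients
  (`cohomologyMap_coresLe`, proved here on cocycles), because truncation sends `m · T⁰ ∈ 𝒯_{p^{n+1}}` to
  `m · T⁰ ∈ 𝒯_{p^n}`; general form `truncH1_coresShapiro_of_le` for `n ≤ n'` along `coresLe`, and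
  `truncH1_coresShapiro_of_coresLe_eq`.
  Consequently a norm-compatible family `(y_n)_n` (`coresLe y_{n+1} = y_n`) yields the compatible
  family `(Sh_n⁻¹ y_n)_n` of `(H¹(K, 𝒯_{p^n}))_n` under truncation — the entrance to `twistTower`.

## References

* J.-P. Serre, *Galois Cohomology* (1997), I §2.5 (Prop. 10 and (b): "`π` donne la corestriction
  `Cor : H^q(H, A) = H^q(G, M_G^H(A)) → H^q(G, A)`"). [SerreGaloisCohomology1997]
* J. Neukirch, A. Schmidt, K. Wingberg, *Cohomology of Number Fields* (2008), (1.6.4)–(1.6.5), I §5.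
  [NeukirchSchmidtWingberg2008]
* K. Kato, Astérisque 295 (2004), §13.8 p. 228 ("`H^q(ℤ[ζ_{p^n}, 1/p], T) ≅ H^q(ℤ[1/p],
  T ⊗ O_λ[G_n])` … `𝐇^q(T) = lim←_n H^q(ℤ[1/p], T ⊗ O_λ[G_n])`"). [Kato2004Asterisque]
-/

noncomputable section

open scoped Topology ContRepresentation
open Field Filter CategoryTheory

universe u w

namespace Literature.NumberTheory.GaloisRepresentations

/-! ## Naturality of the relative corestriction in the coefficients (`TopRep k G`, subgroups) -/

section CoresNaturality

variable {k : Type w} [CommRing k] [TopologicalSpace k]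
variable {G : Type u} [Group G] [TopologicalSpace G] [IsTopologicalGroup G]
variable {X Y : TopRep.{u} k G} {H H' : Subgroup G}

/-- A morphism `X|_{H'} ⟶ Y|_{H'}` of restricted representations (an `H'`-equivariant continuous
linear map, not necessarily `G`-equivariant) restricted further to `H ≤ H'`.
[cite: SerreGaloisCohomology1997, I §2.4] -/
def restrictHomOfLe (h : H ≤ H') (f : subgroupRep X H' ⟶ subgroupRep Y H') :
    subgroupRep X H ⟶ subgroupRep Y H :=
  TopRep.ofHom ⟨f.hom.toContinuousLinearMap, fun g ↦ f.hom.isIntertwining' (Subgroup.inclusion h g)⟩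

omit [TopologicalSpace G] [IsTopologicalGroup G] in
/-- `restrictHomOfLe h f` is `f` on elements. [cite: SerreGaloisCohomology1997, I §2.4] -/
@[simp] theorem restrictHomOfLe_hom_apply (h : H ≤ H') (f : subgroupRep X H' ⟶ subgroupRep Y H')
    (x : X) : (restrictHomOfLe h f).hom x = f.hom x := rfl

/-- **`H¹` of an `H'`-equivariant coefficient map commutes with the relative corestriction
`cor_{H'/H} : H¹(H, ·) → H¹(H', ·)`** (`coresLe`, `H ≤ H'`, `H` open of finite index in `H'`): "Cor is
a morphism of cohomological functors"; on cocycles both sides are the transfer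
`g ↦ Σ_x s(g·x) • f(φ(s(g·x)⁻¹ g s(x)))`, `f` being additive and `H'`-equivariant.
[cite: SerreGaloisCohomology1997, I §2.4] [cite: NeukirchSchmidtWingberg2008, I §5] -/
theorem cohomologyMap_coresLe (h : H ≤ H') (hH : IsOpen (H : Set G))
    [Fintype (H' ⧸ H.subgroupOf H')] (f : subgroupRep X H' ⟶ subgroupRep Y H')
    (c : continuousCohomology 1 (subgroupRep X H)) :
    cohomologyMap f 1 (coresLe X h hH c) =
      coresLe Y h hH (cohomologyMap (restrictHomOfLe h f) 1 c) := by
  obtain ⟨φ, rfl⟩ := oneCocycleClass_surjective _ c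
  rw [coresLe_oneCocycleClass X h hH QuotientGroup.out_eq' φ, cohomologyMap_oneCocycleClass,
    cohomologyMap_oneCocycleClass, coresLe_oneCocycleClass Y h hH QuotientGroup.out_eq']
  refine congrArg _ (Subtype.ext (ContinuousMap.ext fun g ↦ ?_))
  rw [pullback_id_resIdHom_apply, transferCocycle_apply, transferCocycle_apply, transferFun_apply,
    transferFun_apply, map_sum]
  refine Finset.sum_congr rfl fun x _ ↦ ?_
  rw [TopRep.hom_comm_apply f]
  rfl

end CoresNaturality

end Literature.NumberTheory.GaloisRepresentations

namespace Literature.NumberTheory.EllipticCurves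

open Literature.NumberTheory.GaloisRepresentations

namespace ZpExtension

variable {K : Type u} [Field K] {p : ℕ} [Fact p.Prime] (κ : ZpExtension K p)
variable {M : Type u} [AddCommGroup M] [TopologicalSpace M] [DiscreteTopology M]
variable (ρ : DiscreteGaloisModule K M) (hM : ∀ x : M, p • x = 0) (n : ℕ)

/-! ## `M ↪ 𝒯_{p^n}`, `m ↦ m · T⁰`, a `Γ_n`-equivariant map -/

/-- `0 < p^n`. [folklore] -/
private theorem pow_pos_aux : 0 < p ^ n := pow_pos (Fact.out : p.Prime).pos n

/-- `n ≤ p^n`. [folklore] -/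
private theorem le_pow_self_aux : n ≤ p ^ n := (Nat.lt_pow_self (Fact.out : p.Prime).one_lt).le

/-- **`M → 𝒯_{p^n}`, `m ↦ m · T⁰`** (the vector supported at the coefficient of `T⁰`): the unit
`A ↪ M_G^H(A)`-type map of Shapiro's lemma in the `T`-basis (`Pi.single 0`).
[cite: SerreGaloisCohomology1997, I §2.5] -/
def unitCoeff : M →+ (Fin (p ^ n) → M) :=
  AddMonoidHom.single (fun _ : Fin (p ^ n) ↦ M) ⟨0, pow_pos_aux n⟩

omit [TopologicalSpace M] [DiscreteTopology M] in
/-- Unfolding `unitCoeff`: `unitCoeff n m = Pi.single 0 m`. [cite: SerreGaloisCohomology1997, I §2.5] -/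
@[simp] theorem unitCoeff_apply (m : M) :
    unitCoeff (p := p) n m = Pi.single (⟨0, pow_pos_aux n⟩ : Fin (p ^ n)) m := rfl

/-- **`Γ_n` acts on `m · T⁰ ∈ 𝒯_{p^n}` through `ρ`**: `g · (m T⁰) = (ρ(g) m) T⁰` for `g ∈ Γ_n`
(`(1+T)^{κ(g)} = 1` modulo `T^{p^n}` on `Γ_n`, `twistModP_apply_of_mem_layerSubgroup`).
[cite: Washington1997, §13.1–§13.2] -/
theorem twistModP_unitCoeff_of_mem {g : absoluteGaloisGroup K} (hg : g ∈ κ.layerSubgroup n) (m : M) :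
    κ.twistModP ρ hM (p ^ n) g (unitCoeff n m) = unitCoeff n (ρ g m) := by
  rw [κ.twistModP_apply_of_mem_layerSubgroup ρ hM (p ^ n) (le_pow_self_aux n) le_rfl hg,
    unitCoeff_apply, unitCoeff_apply]
  funext i
  exact Pi.apply_single (fun _ (x : M) ↦ ρ g x) (fun _ ↦ map_zero _)
    (⟨0, pow_pos_aux n⟩ : Fin (p ^ n)) m i

/-- **`m ↦ m · T⁰` as a morphism `M|_{Γ_n} ⟶ 𝒯_{p^n}|_{Γ_n}`** of topological representations of
`Γ_n` (both discrete). [cite: SerreGaloisCohomology1997, I §2.5] -/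
def unitCoeffHom :
    subgroupRep ρ.toTopRep (κ.layerSubgroup n) ⟶
      subgroupRep (κ.twistModP ρ hM (p ^ n)).toTopRep (κ.layerSubgroup n) :=
  TopRep.ofHom
    ⟨{ toFun := unitCoeff n
       map_add' := map_add _
       map_smul' := fun c m ↦ by simp only [map_zsmul, RingHom.id_apply]
       cont := continuous_of_discreteTopology },
      fun g ↦ ContinuousLinearMap.ext fun m ↦
        (κ.twistModP_unitCoeff_of_mem ρ hM n g.2 m).symm⟩

/-- `unitCoeffHom` is `unitCoeff` on elements. [cite: SerreGaloisCohomology1997, I §2.5] -/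
@[simp] theorem unitCoeffHom_hom_apply (m : M) :
    (κ.unitCoeffHom ρ hM n).hom m = unitCoeff n m := rfl

/-! ## The inverse Shapiro map as "corestriction after `M ↪ 𝒯_{p^n}`" -/

/-- **`coresShapiro n : H¹(Γ_n, M) → H¹(Γ_K, 𝒯_{p^n})`, `c ↦ cor_{Γ_n}^{Γ_K}(H¹(m ↦ m T⁰)(c))`** —
Serre's description of the corestriction through the induced module read backwards: the inverse of
the Shapiro bijection `H¹(K, 𝒯_{p^n}) ≃ H¹(K_n, M)` (`twistModPH1Equiv_coresShapiro`,
`coresShapiro_eq_symm`).  The finiteness of `Γ_K ⧸ Γ_n` is an instance binder (supply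
`haveI := κ.fintypeQuotientLayer n`). [cite: SerreGaloisCohomology1997, I §2.5 Prop. 10 and (b)]
[cite: NeukirchSchmidtWingberg2008, (1.6.4)–(1.6.5)] -/
def coresShapiro [Fintype (absoluteGaloisGroup K ⧸ κ.layerSubgroup n)] :
    continuousCohomology 1 (subgroupRep ρ.toTopRep (κ.layerSubgroup n)) →+
      galoisCohomology (κ.twistModP ρ hM (p ^ n)) 1 :=
  (cores (κ.twistModP ρ hM (p ^ n)).toTopRep (κ.layerSubgroup n)
      (κ.isOpen_layerSubgroup n)).toAddMonoidHom.comp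
    (cohomologyMap (κ.unitCoeffHom ρ hM n) 1).hom.toLinearMap.toAddMonoidHom

/-- `Γ_n` has finite index `p^n` in `Γ_K` (`index_layerSubgroup`; a private copy of the tree's
`ZpExtension.finiteIndex_layerSubgroup` of `BSDSelmerParityDokchitserTowerProofs.lean`, not imported
here). [folklore] -/
private theorem finiteIndex_layerSubgroup' : (κ.layerSubgroup n).FiniteIndex :=
  ⟨by rw [κ.index_layerSubgroup n]; exact pow_ne_zero _ (Fact.out : p.Prime).ne_zero⟩

/-- A `Fintype` structure on `Γ_K ⧸ Γ_n` (index `p^n`), to feed the instance binder of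
`coresShapiro` / `cores`. [cite: SerreGaloisCohomology1997, I §2.5] -/
@[reducible] def fintypeQuotientLayer :
    Fintype (absoluteGaloisGroup K ⧸ κ.layerSubgroup n) :=
  haveI := κ.finiteIndex_layerSubgroup' n
  Fintype.ofFinite _

/-- `coresShapiro` on explicit cocycles: the class of the transfer of `u ↦ φ(u) · T⁰`.
[cite: SerreGaloisCohomology1997, I §2.5] -/
theorem coresShapiro_oneCocycleClass [Fintype (absoluteGaloisGroup K ⧸ κ.layerSubgroup n)]
    {s : absoluteGaloisGroup K ⧸ κ.layerSubgroup n → absoluteGaloisGroup K}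
    (hs : ∀ x, (s x : absoluteGaloisGroup K ⧸ κ.layerSubgroup n) = x)
    (φ : contOneCocycles (subgroupRep ρ.toTopRep (κ.layerSubgroup n))) :
    κ.coresShapiro ρ hM n (oneCocycleClass _ φ) =
      oneCocycleClass (κ.twistModP ρ hM (p ^ n)).toTopRep
        (transferCocycle (κ.twistModP ρ hM (p ^ n)).toTopRep (κ.layerSubgroup n)
          (κ.isOpen_layerSubgroup n) hs
          (contOneCocycles.pullback (ContinuousMonoidHom.id _)
            (resIdHom (κ.unitCoeffHom ρ hM n)) φ)) := by
  change cores _ _ _ (cohomologyMap (κ.unitCoeffHom ρ hM n) 1 (oneCocycleClass _ φ)) = _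
  rw [cohomologyMap_oneCocycleClass, cores_oneCocycleClass _ _ _ hs]

section ShapiroInverse

variable [Fintype (absoluteGaloisGroup K ⧸ κ.layerSubgroup n)]

/-- The group-ring reading of the transfer: for `g ∈ Γ_K` and a cocycle `φ` on `Γ_n`, the element
`Y(g) = Σ_x δ_{κ̄_n(s(g·x))} · ρ(s(g·x)) φ(s(g·x)⁻¹ g s(x))` of `M ⊗ ℤ[Γ_K/Γ_n]` whose image under the
`T`-basis change `twistGroupRingToModP` is the transfer cocycle of `φ · T⁰` at `g`. [folklore] -/
private def grTransfer {s : absoluteGaloisGroup K ⧸ κ.layerSubgroup n → absoluteGaloisGroup K}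
    (hs : ∀ x, (s x : absoluteGaloisGroup K ⧸ κ.layerSubgroup n) = x)
    (φ : contOneCocycles (subgroupRep ρ.toTopRep (κ.layerSubgroup n)))
    (g : absoluteGaloisGroup K) : ZMod (p ^ n) → M :=
  ∑ x : absoluteGaloisGroup K ⧸ κ.layerSubgroup n,
    Pi.single (κ.layerIndex n (s (g • x)))
      (ρ (s (g • x)) (φ.1 (schreierElt (κ.layerSubgroup n) hs g x)))

omit [Fintype (absoluteGaloisGroup K ⧸ κ.layerSubgroup n)] in
/-- `g · (m T⁰) = toT (δ_{κ̄_n g} · ρ(g) m)` in `𝒯_{p^n}`: the twisted action on a `T⁰`-vector is the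
group-ring vector supported at the coset of `g`, read in the `T`-basis.
[cite: Washington1997, §13.1–§13.2] -/
theorem twistModP_unitCoeff (g : absoluteGaloisGroup K) (m : M) :
    κ.twistModP ρ hM (p ^ n) g (unitCoeff n m) =
      twistGroupRingToModP n (Pi.single (κ.layerIndex n g) (ρ g m)) := by
  funext i
  rw [twistGroupRingToModP_single_apply, twistModP_apply, unitCoeff_apply]
  have h1 : (fun j ↦ ρ g ((Pi.single (⟨0, pow_pos_aux n⟩ : Fin (p ^ n)) m : Fin (p ^ n) → M) j)) =
      (Pi.single (⟨0, pow_pos_aux n⟩ : Fin (p ^ n)) (ρ g m) : Fin (p ^ n) → M) :=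
    funext fun j ↦ Pi.apply_single (fun _ (x : M) ↦ ρ g x) (fun _ ↦ map_zero _)
        (⟨0, pow_pos_aux n⟩ : Fin (p ^ n)) m j
  rw [h1, unipotentPow_eq_of_natCast_eq (n := n) hM
      (a := κ.twistExponent (p ^ n) g) (b := (κ.layerIndex n g).val)
      (by rw [κ.natCast_twistExponent n (p ^ n) (le_pow_self_aux n), ZMod.natCast_zmod_val]),
    unipotentPow_single_zero_apply]

/-- The transfer cocycle of `φ · T⁰` is `toT ∘ Y`. [folklore] -/
private theorem transferCocycle_unitCoeff_apply
    {s : absoluteGaloisGroup K ⧸ κ.layerSubgroup n → absoluteGaloisGroup K}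
    (hs : ∀ x, (s x : absoluteGaloisGroup K ⧸ κ.layerSubgroup n) = x)
    (φ : contOneCocycles (subgroupRep ρ.toTopRep (κ.layerSubgroup n))) (g : absoluteGaloisGroup K) :
    (transferCocycle (κ.twistModP ρ hM (p ^ n)).toTopRep (κ.layerSubgroup n)
        (κ.isOpen_layerSubgroup n) hs
        (contOneCocycles.pullback (ContinuousMonoidHom.id _)
          (resIdHom (κ.unitCoeffHom ρ hM n)) φ)).1 g =
      twistGroupRingToModP n (κ.grTransfer ρ n hs φ g) := by
  rw [transferCocycle_apply, transferFun_apply, grTransfer, map_sum]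
  refine Finset.sum_congr rfl fun x _ ↦ ?_
  rw [pullback_id_resIdHom_apply, unitCoeffHom_hom_apply, ContinuousRep.toTopRep_ρ_apply,
    twistModP_unitCoeff]

/-- On `Γ_n` the identity-coset coefficient of `Y(u)` is `ρ(u₀) φ(u₀⁻¹ u u₀)`, `u₀ = s(1) ∈ Γ_n`.
[folklore] -/
private theorem grTransfer_apply_zero
    {s : absoluteGaloisGroup K ⧸ κ.layerSubgroup n → absoluteGaloisGroup K}
    (hs : ∀ x, (s x : absoluteGaloisGroup K ⧸ κ.layerSubgroup n) = x)
    (φ : contOneCocycles (subgroupRep ρ.toTopRep (κ.layerSubgroup n))) (u : κ.layerSubgroup n) :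
    κ.grTransfer ρ n hs φ (u : absoluteGaloisGroup K) 0 =
      ρ (s 1) (φ.1 (subgroupConj (κ.layerSubgroup n) (s 1) u)) := by
  classical
  rw [grTransfer, Finset.sum_apply, Finset.sum_eq_single (1 : absoluteGaloisGroup K ⧸ κ.layerSubgroup n)]
  · rw [coe_smul_quotient_eq, schreierElt_coe_eq_subgroupConj,
      (κ.layerIndex_eq_zero_iff n (s 1)).2 ((QuotientGroup.eq_one_iff (s 1)).1 (hs 1)),
      Pi.single_eq_same]
  · intro x _ hx
    rw [coe_smul_quotient_eq, Pi.single_apply, if_neg]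
    intro h0
    apply hx
    have hmem : s x ∈ κ.layerSubgroup n := (κ.layerIndex_eq_zero_iff n (s x)).1 h0.symm
    rw [← hs x]
    exact (QuotientGroup.eq_one_iff (s x)).2 hmem
  · intro h
    exact absurd (Finset.mem_univ _) h

variable [CompactSpace (absoluteGaloisGroup K)]

/-- **`Sh_n ∘ coresShapiro n = id`**: the Shapiro bijection `twistModPH1Equiv κ ρ hM n :
H¹(K, 𝒯_{p^n}) ≃ H¹(K_n, M)` of part I sends `cor_{Γ_n}^{Γ_K}[φ · T⁰]` back to `[φ]`.  On cocycles:
the transfer `u ↦ Σ_x s(x)·(φ(s(x)⁻¹ u s(x)) T⁰)` read in the group-ring basis has identity-coset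
coefficient `u ↦ ρ(u₀) φ(u₀⁻¹ u u₀)` (`u₀ = s(1) ∈ Γ_n`), which is `u₀ · φ`, cohomologous to `φ`
(`conjMap_one_apply_of_mem`). [cite: SerreGaloisCohomology1997, I §2.5 Prop. 10 and (b)]
[cite: NeukirchSchmidtWingberg2008, (1.6.4)–(1.6.5)] -/
theorem twistModPH1Equiv_coresShapiro
    (c : continuousCohomology 1 (subgroupRep ρ.toTopRep (κ.layerSubgroup n))) :
    κ.twistModPH1Equiv ρ hM n (κ.coresShapiro ρ hM n c) = c := by
  classical
  obtain ⟨φ, rfl⟩ := oneCocycleClass_surjective _ c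
  have hs : ∀ x : absoluteGaloisGroup K ⧸ κ.layerSubgroup n,
      ((Quotient.out x : absoluteGaloisGroup K) : absoluteGaloisGroup K ⧸ κ.layerSubgroup n) = x :=
    QuotientGroup.out_eq'
  rw [κ.coresShapiro_oneCocycleClass ρ hM n hs φ]
  -- unfold the Shapiro bijection: `sh ∘ H¹(IsoCoind.hom) ∘ H¹(IsoModP.inv)`
  haveI : IsClosed ((κ.layerSubgroup n : Subgroup (absoluteGaloisGroup K)) :
      Set (absoluteGaloisGroup K)) :=
    (κ.layerSubgroup n).isClosed_of_isOpen (κ.isOpen_layerSubgroup n)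
  change shMap (κ.layerSubgroup n) ρ 1
    ((cohomologyMap (κ.twistGroupRingIsoCoind ρ n).hom 1).hom
      ((cohomologyMap (κ.twistGroupRingIsoModP ρ hM n).symm.hom 1).hom
        (oneCocycleClass _ (transferCocycle (κ.twistModP ρ hM (p ^ n)).toTopRep (κ.layerSubgroup n)
          (κ.isOpen_layerSubgroup n) hs
          (contOneCocycles.pullback (ContinuousMonoidHom.id _)
            (resIdHom (κ.unitCoeffHom ρ hM n)) φ))))) = _
  rw [Iso.symm_hom, cohomologyMap_oneCocycleClass, cohomologyMap_oneCocycleClass]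
  erw [map_oneCocycleClass _ (subgroupIncl (κ.layerSubgroup n)) (coindEvalOne (κ.restrictLayer ρ n))]
  -- the resulting cocycle on `Γ_n` is `u₀ · φ`, `u₀ = s(1)`
  have hu₀ : (Quotient.out (1 : absoluteGaloisGroup K ⧸ κ.layerSubgroup n)) ∈ κ.layerSubgroup n :=
    (QuotientGroup.eq_one_iff _).1 (hs 1)
  have key : ∀ u : κ.layerSubgroup n,
      (coindEvalOne (κ.restrictLayer ρ n)).hom
        ((κ.twistGroupRingIsoCoind ρ n).hom.hom
          ((κ.twistGroupRingIsoModP ρ hM n).inv.hom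
            ((transferCocycle (κ.twistModP ρ hM (p ^ n)).toTopRep (κ.layerSubgroup n)
              (κ.isOpen_layerSubgroup n) hs
              (contOneCocycles.pullback (ContinuousMonoidHom.id _)
                (resIdHom (κ.unitCoeffHom ρ hM n)) φ)).1 (u : absoluteGaloisGroup K)))) =
        ρ (Quotient.out (1 : absoluteGaloisGroup K ⧸ κ.layerSubgroup n))
          (φ.1 (subgroupConj (κ.layerSubgroup n)
            (Quotient.out (1 : absoluteGaloisGroup K ⧸ κ.layerSubgroup n)) u)) := by
    intro u
    rw [κ.transferCocycle_unitCoeff_apply ρ hM n hs φ u]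
    -- `IsoModP.inv (toT y) = y`
    have hinv : (κ.twistGroupRingIsoModP ρ hM n).inv.hom
        (twistGroupRingToModP n (κ.grTransfer ρ n hs φ u)) = κ.grTransfer ρ n hs φ u := by
      change (κ.twistGroupRingIsoModP ρ hM n).inv.hom
        ((κ.twistGroupRingIsoModP ρ hM n).hom.hom (κ.grTransfer ρ n hs φ u)) = _
      rw [← TopRep.comp_apply, Iso.hom_inv_id, TopRep.id_apply]
    rw [hinv]
    change ((κ.twistGroupRingEquivCoind ρ n (κ.grTransfer ρ n hs φ u) :
        coindModule (κ.restrictLayer ρ n)) : C(absoluteGaloisGroup K, M)) 1 = _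
    rw [coe_twistGroupRingEquivCoind_apply, layerIndex_one, neg_zero, map_one, Module.End.one_apply,
      grTransfer_apply_zero]
  have hcocycle :
      contOneCocycles.pullback (subgroupIncl (κ.layerSubgroup n)) (coindEvalOne (κ.restrictLayer ρ n))
        (contOneCocycles.pullback (ContinuousMonoidHom.id _)
          (resIdHom (κ.twistGroupRingIsoCoind ρ n).hom)
          (contOneCocycles.pullback (ContinuousMonoidHom.id _)
            (resIdHom (κ.twistGroupRingIsoModP ρ hM n).inv)
            (transferCocycle (κ.twistModP ρ hM (p ^ n)).toTopRep (κ.layerSubgroup n)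
              (κ.isOpen_layerSubgroup n) hs
              (contOneCocycles.pullback (ContinuousMonoidHom.id _)
                (resIdHom (κ.unitCoeffHom ρ hM n)) φ)))) =
      contOneCocycles.pullback (subgroupConj (κ.layerSubgroup n)
          (Quotient.out (1 : absoluteGaloisGroup K ⧸ κ.layerSubgroup n)))
        (conjRepHom ρ.toTopRep (κ.layerSubgroup n)
          (Quotient.out (1 : absoluteGaloisGroup K ⧸ κ.layerSubgroup n))) φ := by
    refine Subtype.ext (ContinuousMap.ext fun u ↦ ?_)
    rw [contOneCocycles.pullback_apply, pullback_id_resIdHom_apply, pullback_id_resIdHom_apply,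
      conj_pullback_apply]
    exact key u
  rw [hcocycle]
  change oneCocycleClass (subgroupRep ρ.toTopRep (κ.layerSubgroup n)) _ = _
  rw [← conjMap_oneCocycleClass]
  exact conjMap_one_apply_of_mem ρ.toTopRep (κ.layerSubgroup n) ⟨_, hu₀⟩ _

/-- **`coresShapiro n = Sh_n⁻¹`** as functions: corestriction after `M ↪ 𝒯_{p^n}` IS the inverse of the
Shapiro bijection. [cite: SerreGaloisCohomology1997, I §2.5 Prop. 10 and (b)] -/
theorem coresShapiro_eq_symm (c : continuousCohomology 1 (subgroupRep ρ.toTopRep (κ.layerSubgroup n))) :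
    κ.coresShapiro ρ hM n c = (κ.twistModPH1Equiv ρ hM n).symm c :=
  (κ.twistModPH1Equiv ρ hM n).injective
    (by rw [twistModPH1Equiv_coresShapiro, Equiv.apply_symm_apply])

/-- `coresShapiro n ∘ Sh_n = id`. [cite: SerreGaloisCohomology1997, I §2.5 Prop. 10] -/
theorem coresShapiro_twistModPH1Equiv (c : galoisCohomology (κ.twistModP ρ hM (p ^ n)) 1) :
    κ.coresShapiro ρ hM n (κ.twistModPH1Equiv ρ hM n c) = c := by
  rw [coresShapiro_eq_symm, Equiv.symm_apply_apply]

/-- `coresShapiro n` is a bijection `H¹(K_n, M) → H¹(K, 𝒯_{p^n})`.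
[cite: SerreGaloisCohomology1997, I §2.5 Prop. 10] -/
theorem coresShapiro_bijective : Function.Bijective (κ.coresShapiro ρ hM n) := by
  have h : ⇑(κ.coresShapiro ρ hM n) = ⇑(κ.twistModPH1Equiv ρ hM n).symm :=
    funext (κ.coresShapiro_eq_symm ρ hM n)
  rw [h]
  exact (κ.twistModPH1Equiv ρ hM n).symm.bijective

/-- In particular `coresShapiro n c = 0 ↔ c = 0` (non-zero classes of `H¹(K_n, M)` have non-zero
image in `H¹(K, 𝒯_{p^n})`). [cite: SerreGaloisCohomology1997, I §2.5 Prop. 10] -/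
theorem coresShapiro_eq_zero_iff (c : continuousCohomology 1 (subgroupRep ρ.toTopRep (κ.layerSubgroup n))) :
    κ.coresShapiro ρ hM n c = 0 ↔ c = 0 :=
  ⟨fun h ↦ (κ.coresShapiro_bijective ρ hM n).1 (by rw [h, map_zero]), fun h ↦ by rw [h, map_zero]⟩

end ShapiroInverse

/-! ## Corestriction ↔ truncation -/

/-- Truncation `𝒯_{p^{n+1}} → 𝒯_{p^n}` fixes `m · T⁰`. [cite: Washington1997, §13.1–§13.2] -/
theorem twistModPTruncate_unitCoeff {n n' : ℕ} (h : p ^ n ≤ p ^ n') (m : M) :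
    κ.twistModPTruncate ρ hM (p ^ n') h (unitCoeff n' m) = unitCoeff n m := by
  funext i
  rw [twistModPTruncate_apply, unitCoeff_apply, unitCoeff_apply]
  by_cases hi : i = ⟨0, pow_pos_aux n⟩
  · subst hi
    rw [Pi.single_eq_same, show Fin.castLE h ⟨0, pow_pos_aux n⟩ = ⟨0, pow_pos_aux n'⟩ from rfl,
      Pi.single_eq_same]
  · rw [Pi.single_eq_of_ne hi, Pi.single_eq_of_ne]
    intro h0
    apply hi
    have h0' : (i : ℕ) = 0 := by simpa using congrArg Fin.val h0
    exact Fin.ext h0'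

/-- **Corestriction ↔ truncation**: for `n ≤ n'` and `c ∈ H¹(Γ_{n'}, M)`,
`trunc_{p^n ← p^{n'}} (coresShapiro n' c) = coresShapiro n (cor_{Γ_{n'} → Γ_n} c)` in `H¹(K, 𝒯_{p^n})`
— the trace maps of the `ℤ_p`-tower become the projections `𝒯_{p^{n'}} → 𝒯_{p^n}` under Shapiro
(Kato: "the inverse limit is taken with respect to trace maps" = `lim←_n H^q(ℤ[1/p], T ⊗ O_λ[G_n])`).
Formal from the transitivity of the transfer (`cores_coresLe_eq_cores`) and its naturality in the
coefficients (`cohomologyMap_coresLe`), since truncation fixes `m · T⁰`.  All finiteness structures are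
instance binders (any instances; e.g. `Kato2004.layerCores` unfolds to the `coresLe` below for
`n' = n + 1`). [cite: SerreGaloisCohomology1997, I §2.5 (b)] [cite: Kato2004Asterisque, §13.8 (p. 228)] -/
theorem truncH1_coresShapiro_of_le {n n' : ℕ} (hn : n ≤ n')
    [Fintype (absoluteGaloisGroup K ⧸ κ.layerSubgroup n)]
    [Fintype (absoluteGaloisGroup K ⧸ κ.layerSubgroup n')]
    [Fintype (κ.layerSubgroup n ⧸ (κ.layerSubgroup n').subgroupOf (κ.layerSubgroup n))]
    (c : continuousCohomology 1 (subgroupRep ρ.toTopRep (κ.layerSubgroup n'))) :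
    κ.truncH1 ρ hM (Nat.pow_le_pow_right (Fact.out : p.Prime).pos hn)
        (κ.coresShapiro ρ hM n' c) =
      κ.coresShapiro ρ hM n
        (coresLe ρ.toTopRep (κ.layerSubgroup_antitone hn) (κ.isOpen_layerSubgroup n') c) := by
  classical
  have hle : p ^ n ≤ p ^ n' := Nat.pow_le_pow_right (Fact.out : p.Prime).pos hn
  have hs : ∀ x : absoluteGaloisGroup K ⧸ κ.layerSubgroup n',
      ((Quotient.out x : absoluteGaloisGroup K) : absoluteGaloisGroup K ⧸ κ.layerSubgroup n') = x :=
    QuotientGroup.out_eq'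
  -- RHS: naturality of `coresLe` in the coefficients, then transitivity of the transfer
  have hR : κ.coresShapiro ρ hM n (coresLe ρ.toTopRep (κ.layerSubgroup_antitone hn)
        (κ.isOpen_layerSubgroup n') c) =
      cores (κ.twistModP ρ hM (p ^ n)).toTopRep (κ.layerSubgroup n')
        (κ.isOpen_layerSubgroup n')
        (cohomologyMap (restrictHomOfLe (X := ρ.toTopRep) (Y := (κ.twistModP ρ hM (p ^ n)).toTopRep)
          (H := κ.layerSubgroup n') (H' := κ.layerSubgroup n) (κ.layerSubgroup_antitone hn)
          (κ.unitCoeffHom ρ hM n)) 1 c) := by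
    change cores _ _ _ (cohomologyMap (κ.unitCoeffHom ρ hM n) 1 (coresLe ρ.toTopRep _ _ c)) = _
    rw [cohomologyMap_coresLe, cores_coresLe_eq_cores]
  rw [hR]
  obtain ⟨φ, rfl⟩ := oneCocycleClass_surjective _ c
  rw [κ.coresShapiro_oneCocycleClass ρ hM n' hs φ, truncH1, map_oneCocycleClass_twist,
    cohomologyMap_oneCocycleClass, cores_oneCocycleClass _ _ _ hs]
  refine congrArg _ (Subtype.ext (ContinuousMap.ext fun g ↦ ?_))
  rw [pushCocycle_apply, transferCocycle_apply, transferCocycle_apply, transferFun_apply,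
    transferFun_apply, map_sum]
  refine Finset.sum_congr rfl fun x _ ↦ ?_
  rw [pullback_id_resIdHom_apply, pullback_id_resIdHom_apply, unitCoeffHom_hom_apply,
    restrictHomOfLe_hom_apply, unitCoeffHom_hom_apply, ContinuousRep.toTopRep_ρ_apply,
    ContinuousRep.toTopRep_ρ_apply, ← κ.twistModPTruncate_unitCoeff ρ hM hle]
  exact (ContinuousRep.hom_comm_apply
    (TopRep.ofHom ⟨(κ.twistModPTruncate ρ hM (p ^ n') hle).toContinuousLinearMap,
      (κ.twistModPTruncate ρ hM (p ^ n') hle).isIntertwining'⟩) _ _)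

/-- **Corestriction ↔ truncation, one step** (`n' = n + 1`, the shape of `Kato2004.layerCores` /
`Kato2004.IsNormCompatible`): `trunc_{p^n ← p^{n+1}} (coresShapiro (n+1) c) =
coresShapiro n (cor_{Γ_{n+1} → Γ_n} c)`.  Consequently a norm-compatible family `(y_n)_n`
(`cor y_{n+1} = y_n`) gives the truncation-compatible family `(coresShapiro n y_n)_n = (Sh_n⁻¹ y_n)_n`
of `(H¹(K, 𝒯_{p^n}))_n`. [cite: SerreGaloisCohomology1997, I §2.5 (b)] [cite: Kato2004Asterisque, §13.8 (p. 228)] -/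
theorem truncH1_coresShapiro_succ
    [Fintype (absoluteGaloisGroup K ⧸ κ.layerSubgroup n)]
    [Fintype (absoluteGaloisGroup K ⧸ κ.layerSubgroup (n + 1))]
    [Fintype (κ.layerSubgroup n ⧸ (κ.layerSubgroup (n + 1)).subgroupOf (κ.layerSubgroup n))]
    (c : continuousCohomology 1 (subgroupRep ρ.toTopRep (κ.layerSubgroup (n + 1)))) :
    κ.truncH1 ρ hM (Nat.pow_le_pow_right (Fact.out : p.Prime).pos n.le_succ)
        (κ.coresShapiro ρ hM (n + 1) c) =
      κ.coresShapiro ρ hM n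
        (coresLe ρ.toTopRep (κ.layerSubgroup_antitone n.le_succ)
          (κ.isOpen_layerSubgroup (n + 1)) c) :=
  κ.truncH1_coresShapiro_of_le ρ hM n.le_succ c

/-- **The norm-compatible ↔ truncation-compatible dictionary**: if `cor_{Γ_{n+1} → Γ_n} y_{n+1} = y_n`
then `trunc_{p^n ← p^{n+1}} (coresShapiro (n+1) y_{n+1}) = coresShapiro n y_n`.
[cite: SerreGaloisCohomology1997, I §2.5 (b)] [cite: Kato2004Asterisque, §12.2 (p. 220) and §13.8 (p. 228)] -/
theorem truncH1_coresShapiro_of_coresLe_eq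
    [Fintype (absoluteGaloisGroup K ⧸ κ.layerSubgroup n)]
    [Fintype (absoluteGaloisGroup K ⧸ κ.layerSubgroup (n + 1))]
    [Fintype (κ.layerSubgroup n ⧸ (κ.layerSubgroup (n + 1)).subgroupOf (κ.layerSubgroup n))]
    {y : continuousCohomology 1 (subgroupRep ρ.toTopRep (κ.layerSubgroup n))}
    {y' : continuousCohomology 1 (subgroupRep ρ.toTopRep (κ.layerSubgroup (n + 1)))}
    (h : coresLe ρ.toTopRep (κ.layerSubgroup_antitone n.le_succ) (κ.isOpen_layerSubgroup (n + 1)) y' = y) :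
    κ.truncH1 ρ hM (Nat.pow_le_pow_right (Fact.out : p.Prime).pos n.le_succ)
        (κ.coresShapiro ρ hM (n + 1) y') = κ.coresShapiro ρ hM n y := by
  rw [truncH1_coresShapiro_succ, h]

end ZpExtension

end Literature.NumberTheory.EllipticCurves

end
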